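import Literature.Computability.Learning.LearnerHypFP
import Literature.Computability.Complexity.PlumbingBricks
import HarnessLib

/-!
# The learner's coin layout and query schedule in `FP`

Machine-layer instalment (M8e-1) of the decomposition of the named fact
`Literature.Computability.Learning.cikk_natural_implies_learning` (CIKK 2016, Thm. 5.1): the
per-level lengths of the coin layout (`runLen`, `blockLen = Reps·runLen + m·n`), the coin
offset `coff ℓ = Σ_{ℓ'<ℓ} blockLen ℓ'` of level `ℓ` and the processedness test (the level's block
fits into the coins), as plain functions of `(n, a, b, |r|, ℓ)` (`lvl…`) and as unary string
functions on `⟨x, 1^ℓ⟩` with capped parameters; the key lemma `capsExact_of_processed` shows that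
on processed levels the capped parameters are the true ones.

## References

* M. Carmosino, R. Impagliazzo, V. Kabanets, A. Kolokolova, *Learning algorithms from natural
  proofs*, CCC 2016, §5 [CarmosinoImpagliazzoKabanetsKolokolova2016].
-/

open Polynomial

namespace Literature.Computability.Learning

open Literature.Computability.Complexity Literature.Computability.Complexity.Brick
  Literature.Computability.Complexity.Plumb Literature.Computability.MetaComplexity
  Literature.Computability.Cryptography _root_.Computability Finset

/-! ### True per-level quantities -/

section Level

variable (n a b : ℕ)

/-- `k` at level `ℓ`. [folklore] -/
def lvlK (ℓ : ℕ) : ℕ := prmK (prmS n a b) ℓ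
/-- `q` at level `ℓ`: the least prime `≥ kn + k`. [folklore] -/
def lvlQ (ℓ : ℕ) : ℕ := prmQ (lvlK n a b ℓ * n + lvlK n a b ℓ)
/-- The coin length of one run at level `ℓ`. [folklore] -/
def lvlRunLen (ℓ : ℕ) : ℕ :=
  runLen n (lvlK n a b ℓ) ℓ (prmKK (prmS n a b) ℓ) (prmT (prmS n a b) ℓ) (lvlQ n a b ℓ) (prmKappa (prmS n a b) ℓ)
/-- The coin length of level `ℓ`: `Reps` runs and `m` validation points. [folklore] -/
def lvlBlockLen (ℓ : ℕ) : ℕ := prmReps (prmS n a b) ℓ * lvlRunLen n a b ℓ + prmM (prmS n a b) ℓ * n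
/-- The coin offset of level `ℓ`. [folklore] -/
def lvlCoff (ℓ : ℕ) : ℕ := ∑ ℓ' ∈ Finset.range ℓ, lvlBlockLen n a b ℓ'
/-- Level `ℓ` is processed with `R` coins: its block fits. [folklore] -/
def LvlProcessed (R ℓ : ℕ) : Prop := lvlCoff n a b (ℓ + 1) ≤ R

/-- Processedness is decidable. [folklore] -/
instance (R ℓ : ℕ) : Decidable (LvlProcessed n a b R ℓ) := by unfold LvlProcessed; infer_instance

end Level

/-! ### Capped per-level quantities (what the machine computes) -/

section Capped

variable (n a b R : ℕ)

/-- Capped `k`. [folklore] -/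
def capK (ℓ : ℕ) : ℕ := min (prmK (prmS n a b) ℓ) R
/-- Capped `L`. [folklore] -/
def capL (ℓ : ℕ) : ℕ := min (2 ^ ℓ) R
/-- Capped `t`. [folklore] -/
def capT (ℓ : ℕ) : ℕ := min (prmT (prmS n a b) ℓ) R
/-- Capped `Reps`. [folklore] -/
def capReps (ℓ : ℕ) : ℕ := min (prmReps (prmS n a b) ℓ) R
/-- `q` from the capped `k`. [folklore] -/
def capQ (ℓ : ℕ) : ℕ := prmQ (capK n a b R ℓ * n + capK n a b R ℓ)
/-- The run length from capped parameters (as the machine computes it). [folklore] -/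
def capRunLen (ℓ : ℕ) : ℕ :=
  ℓ + capQ n a b R ℓ * capQ n a b R ℓ + capL R ℓ + prmKK (prmS n a b) ℓ * capK n a b R ℓ + prmKK (prmS n a b) ℓ +
    capK n a b R ℓ + capK n a b R ℓ * n + capT n a b R ℓ * (prmKappa (prmS n a b) ℓ + capK n a b R ℓ * n)
/-- The block length from capped parameters. [folklore] -/
def capBlockLen (ℓ : ℕ) : ℕ := capReps n a b R ℓ * capRunLen n a b R ℓ + prmM (prmS n a b) ℓ * n
/-- The capped offset: `min (Σ_{ℓ'<ℓ} capBlockLen ℓ') (R+1)`. [folklore] -/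
def capCoff (ℓ : ℕ) : ℕ := min (∑ ℓ' ∈ Finset.range ℓ, capBlockLen n a b R ℓ') (R + 1)

/-- All caps at level `ℓ` are inactive. [folklore] -/
def CapsExact (ℓ : ℕ) : Prop :=
  prmK (prmS n a b) ℓ ≤ R ∧ 2 ^ ℓ ≤ R ∧ prmT (prmS n a b) ℓ ≤ R ∧ prmReps (prmS n a b) ℓ ≤ R

variable {n a b R}

/-- With inactive caps the capped quantities are the true ones. [folklore] -/
theorem cap_eq_of_capsExact {ℓ : ℕ} (h : CapsExact n a b R ℓ) :
    capK n a b R ℓ = lvlK n a b ℓ ∧ capL R ℓ = 2 ^ ℓ ∧ capT n a b R ℓ = prmT (prmS n a b) ℓ ∧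
      capReps n a b R ℓ = prmReps (prmS n a b) ℓ ∧ capQ n a b R ℓ = lvlQ n a b ℓ ∧
      capRunLen n a b R ℓ = lvlRunLen n a b ℓ ∧ capBlockLen n a b R ℓ = lvlBlockLen n a b ℓ := by
  obtain ⟨h1, h2, h3, h4⟩ := h
  have hk : capK n a b R ℓ = lvlK n a b ℓ := min_eq_left h1
  have hq : capQ n a b R ℓ = lvlQ n a b ℓ := by rw [capQ, hk, lvlQ]
  have hrl : capRunLen n a b R ℓ = lvlRunLen n a b ℓ := by
    rw [capRunLen, hq, hk, capL, min_eq_left h2, capT, min_eq_left h3, lvlRunLen]; rfl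
  refine ⟨hk, min_eq_left h2, min_eq_left h3, min_eq_left h4, hq, hrl, ?_⟩
  rw [capBlockLen, capReps, min_eq_left h4, hrl, lvlBlockLen]

/-- `kk ≥ 28`. [folklore] -/
theorem prmKK_ge (s ℓ : ℕ) : 28 ≤ prmKK s ℓ := by rw [prmKK, prmKappa]; omega

/-- A capped exponential quantity is positive once `R ≥ 1`. [folklore] -/
theorem one_le_min_two_pow {e R : ℕ} (hR : 1 ≤ R) : 1 ≤ min (2 ^ e) R := le_min (Nat.one_le_two_pow) hR

/-- **If the capped block of level `ℓ` fits into `R ≥ 1` coins, no cap is active at `ℓ`.** [folklore] -/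
theorem capsExact_of_capBlockLen_le {ℓ : ℕ} (hR : 1 ≤ R) (h : capBlockLen n a b R ℓ ≤ R) : CapsExact n a b R ℓ := by
  have hkk := prmKK_ge (prmS n a b) ℓ
  have hReps : 1 ≤ capReps n a b R ℓ := one_le_min_two_pow hR
  have hT : 1 ≤ capT n a b R ℓ := one_le_min_two_pow hR
  have hrun : capRunLen n a b R ℓ ≤ R := by
    have : capRunLen n a b R ℓ ≤ capReps n a b R ℓ * capRunLen n a b R ℓ := Nat.le_mul_of_pos_left _ hReps
    rw [capBlockLen] at h; omega
  have hbig : capL R ℓ + prmKK (prmS n a b) ℓ * capK n a b R ℓ + prmKK (prmS n a b) ℓ + capK n a b R ℓ +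
      capT n a b R ℓ * (prmKappa (prmS n a b) ℓ + capK n a b R ℓ * n) ≤ R := by rw [capRunLen] at hrun; omega
  have hκ : 20 ≤ prmKappa (prmS n a b) ℓ := by rw [prmKappa]; omega
  have hTT : 20 * capT n a b R ℓ ≤ capT n a b R ℓ * (prmKappa (prmS n a b) ℓ + capK n a b R ℓ * n) := by
    rw [mul_comm]; exact Nat.mul_le_mul_left _ (le_trans hκ (Nat.le_add_right _ _))
  have hKK : 28 * capK n a b R ℓ ≤ prmKK (prmS n a b) ℓ * capK n a b R ℓ := Nat.mul_le_mul_right _ hkk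
  refine ⟨?_, ?_, ?_, ?_⟩
  · by_contra hc
    have : capK n a b R ℓ = R := min_eq_right (not_le.1 hc).le
    omega
  · by_contra hc
    have : capL R ℓ = R := min_eq_right (not_le.1 hc).le
    omega
  · by_contra hc
    have : capT n a b R ℓ = R := min_eq_right (not_le.1 hc).le
    omega
  · by_contra hc
    have hc' : capReps n a b R ℓ = R := min_eq_right (not_le.1 hc).le
    have h28 : 28 ≤ capRunLen n a b R ℓ := by rw [capRunLen]; omega
    have : R * 28 ≤ capReps n a b R ℓ * capRunLen n a b R ℓ := by rw [hc']; exact Nat.mul_le_mul_left _ h28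
    rw [capBlockLen] at h; omega

/-- **Processedness is the same for capped and true quantities, and on processed levels all caps
are inactive** (by induction on the level). [folklore] -/
theorem capCoff_spec (hR : 1 ≤ R) : ∀ ℓ : ℕ, capCoff n a b R ℓ ≤ R →
    (∀ ℓ' < ℓ, CapsExact n a b R ℓ') ∧ (∑ ℓ' ∈ Finset.range ℓ, capBlockLen n a b R ℓ') = lvlCoff n a b ℓ
  | 0 => fun _ => ⟨fun _ h => absurd h (Nat.not_lt_zero _), by rw [lvlCoff, Finset.sum_range_zero, Finset.sum_range_zero]⟩
  | ℓ + 1 => fun h => by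
    have hsum : ∑ ℓ' ∈ Finset.range (ℓ + 1), capBlockLen n a b R ℓ' ≤ R := by
      by_contra hc
      rw [capCoff, min_eq_right (by omega)] at h
      omega
    have hsum' := hsum
    rw [Finset.sum_range_succ] at hsum'
    have hprev : capCoff n a b R ℓ ≤ R := (min_le_left _ _).trans ((Nat.le_add_right _ _).trans hsum')
    obtain ⟨ih1, ih2⟩ := capCoff_spec hR ℓ hprev
    have hex : CapsExact n a b R ℓ := capsExact_of_capBlockLen_le hR ((Nat.le_add_left _ _).trans hsum')
    refine ⟨fun ℓ' hℓ' => ?_, ?_⟩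
    · rcases Nat.lt_succ_iff_lt_or_eq.1 hℓ' with hlt | heq
      · exact ih1 ℓ' hlt
      · rw [heq]; exact hex
    · rw [Finset.sum_range_succ, ih2, (cap_eq_of_capsExact hex).2.2.2.2.2.2, lvlCoff, lvlCoff, Finset.sum_range_succ]

/-- On a level whose capped offset test passes, the capped offset is the true offset. [folklore] -/
theorem capCoff_eq_lvlCoff (hR : 1 ≤ R) {ℓ : ℕ} (h : capCoff n a b R ℓ ≤ R) : capCoff n a b R ℓ = lvlCoff n a b ℓ := by
  have h2 := (capCoff_spec hR ℓ h).2
  have hle : ∑ ℓ' ∈ Finset.range ℓ, capBlockLen n a b R ℓ' ≤ R := by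
    by_contra hc; rw [capCoff, min_eq_right (by omega)] at h; omega
  rw [capCoff, min_eq_left (by omega), h2]

/-- **Capped processedness is true processedness.** [folklore] -/
theorem capCoff_succ_le_iff (hR : 1 ≤ R) (ℓ : ℕ) : capCoff n a b R (ℓ + 1) ≤ R ↔ LvlProcessed n a b R ℓ := by
  constructor
  · intro h; rw [LvlProcessed, ← capCoff_eq_lvlCoff hR h]; exact h
  · intro h
    rw [LvlProcessed] at h
    -- true quantities dominate capped ones
    have hle : ∀ ℓ', capBlockLen n a b R ℓ' ≤ lvlBlockLen n a b ℓ' := by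
      intro ℓ'
      have hk : capK n a b R ℓ' ≤ lvlK n a b ℓ' := min_le_left _ _
      have hq : capQ n a b R ℓ' ≤ lvlQ n a b ℓ' := by
        rw [capQ, lvlQ]
        rcases eq_or_ne (capK n a b R ℓ' * n + capK n a b R ℓ') 0 with h0 | h0
        · rw [h0]; exact (prmQ_min (Nat.zero_le 2) Nat.prime_two).trans (prmQ_spec _).2.two_le
        · exact prmQ_min ((Nat.add_le_add (Nat.mul_le_mul_right _ hk) hk).trans (prmQ_spec _).1) (prmQ_spec _).2
      have hrl : capRunLen n a b R ℓ' ≤ lvlRunLen n a b ℓ' := by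
        rw [capRunLen, lvlRunLen, runLen, offSt, offA, offPb, offSg, offSd, offW, stepLen]
        have h1 : capL R ℓ' ≤ 2 ^ ℓ' := min_le_left _ _
        have h2 : capT n a b R ℓ' ≤ prmT (prmS n a b) ℓ' := min_le_left _ _
        have h3 := Nat.mul_le_mul hq hq
        have h4 := Nat.mul_le_mul_left (prmKK (prmS n a b) ℓ') hk
        have h5 := Nat.mul_le_mul_right n hk
        have h6 := Nat.mul_le_mul h2 (Nat.add_le_add_left h5 (prmKappa (prmS n a b) ℓ'))
        rw [lvlK] at *
        omega
      rw [capBlockLen, lvlBlockLen]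
      exact Nat.add_le_add_right (Nat.mul_le_mul (min_le_left _ _) hrl) _
    rw [capCoff]
    exact (min_le_left _ _).trans ((Finset.sum_le_sum fun ℓ' _ => hle ℓ').trans h)

end Capped

/-! ### The bricks -/

/-- `1^{runLen}` (capped parameters) on `⟨x, 1^ℓ⟩`. [folklore] -/
noncomputable def runLenFn : List Bool → List Bool :=
  (appF ∘ (fanoutFn sndF (appF ∘ (fanoutFn (HashBricks.umulFn ∘ (fanoutFn qFn qFn)) (appF ∘ (fanoutFn bigLFn (appF ∘ (fanoutFn (HashBricks.umulFn ∘ (fanoutFn kkFn kFn)) (appF ∘ (fanoutFn kkFn (appF ∘ (fanoutFn kFn (appF ∘ (fanoutFn (HashBricks.umulFn ∘ (fanoutFn kFn (nthF 0 ∘ (fstF ∘ fstF)))) (HashBricks.umulFn ∘ (fanoutFn tFn (appF ∘ (fanoutFn kappaFn (HashBricks.umulFn ∘ (fanoutFn kFn (nthF 0 ∘ (fstF ∘ fstF))))))))))))))))))))))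

/-- `runLenFn ∈ FP`. [folklore] -/
theorem runLenFn_mem_FP : runLenFn ∈ FP :=
  (comp_mem_FP appF_mem_FP (fanoutFn_mem_FP sndF_mem_FP (comp_mem_FP appF_mem_FP (fanoutFn_mem_FP (comp_mem_FP HashBricks.umulFn_mem_FP (fanoutFn_mem_FP qFn_mem_FP qFn_mem_FP)) (comp_mem_FP appF_mem_FP (fanoutFn_mem_FP bigLFn_mem_FP (comp_mem_FP appF_mem_FP (fanoutFn_mem_FP (comp_mem_FP HashBricks.umulFn_mem_FP (fanoutFn_mem_FP kkFn_mem_FP kFn_mem_FP)) (comp_mem_FP appF_mem_FP (fanoutFn_mem_FP kkFn_mem_FP (comp_mem_FP appF_mem_FP (fanoutFn_mem_FP kFn_mem_FP (comp_mem_FP appF_mem_FP (fanoutFn_mem_FP (comp_mem_FP HashBricks.umulFn_mem_FP (fanoutFn_mem_FP kFn_mem_FP (comp_mem_FP (nthF_mem_FP 0) (comp_mem_FP fstF_mem_FP fstF_mem_FP)))) (comp_mem_FP HashBricks.umulFn_mem_FP (fanoutFn_mem_FP tFn_mem_FP (comp_mem_FP appF_mem_FP (fanoutFn_mem_FP kappaFn_mem_FP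 (comp_mem_FP HashBricks.umulFn_mem_FP (fanoutFn_mem_FP kFn_mem_FP (comp_mem_FP (nthF_mem_FP 0) (comp_mem_FP fstF_mem_FP fstF_mem_FP))))))))))))))))))))))

/-- `1^{blockLen}`, `blockLen = Reps·runLen + m·n`, on `⟨x, 1^ℓ⟩`. [folklore] -/
noncomputable def blockLenFn : List Bool → List Bool :=
  (appF ∘ (fanoutFn (HashBricks.umulFn ∘ (fanoutFn repsFn runLenFn)) (HashBricks.umulFn ∘ (fanoutFn mFn (nthF 0 ∘ (fstF ∘ fstF))))))

/-- `blockLenFn ∈ FP`. [folklore] -/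
theorem blockLenFn_mem_FP : blockLenFn ∈ FP :=
  (comp_mem_FP appF_mem_FP (fanoutFn_mem_FP (comp_mem_FP HashBricks.umulFn_mem_FP (fanoutFn_mem_FP repsFn_mem_FP runLenFn_mem_FP)) (comp_mem_FP HashBricks.umulFn_mem_FP (fanoutFn_mem_FP mFn_mem_FP (comp_mem_FP (nthF_mem_FP 0) (comp_mem_FP fstF_mem_FP fstF_mem_FP))))))

/-- The piece of the offset fold on `⟨x, 1^{ℓ'}⟩`: `⟨blockLen(ℓ') ↾ (|r|+1), 1^{|r|+1}⟩`. [folklore] -/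
noncomputable def coffPiece : List Bool → List Bool :=
  (fanoutFn (takeFn ∘ (fanoutFn (appF ∘ (fanoutFn (onesFn ∘ (sndF ∘ fstF)) (fun _ => [true]))) blockLenFn)) (appF ∘ (fanoutFn (onesFn ∘ (sndF ∘ fstF)) (fun _ => [true]))))

/-- `coffPiece ∈ FP`. [folklore] -/
theorem coffPiece_mem_FP : coffPiece ∈ FP :=
  (fanoutFn_mem_FP (comp_mem_FP takeFn_mem_FP (fanoutFn_mem_FP (comp_mem_FP appF_mem_FP (fanoutFn_mem_FP (comp_mem_FP onesFn_mem_FP (comp_mem_FP sndF_mem_FP fstF_mem_FP)) (const_mem_FP _))) blockLenFn_mem_FP)) (comp_mem_FP appF_mem_FP (fanoutFn_mem_FP (comp_mem_FP onesFn_mem_FP (comp_mem_FP sndF_mem_FP fstF_mem_FP)) (const_mem_FP _))))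

/-- The op of the offset fold: `⟨acc, ⟨b, cap⟩⟩ ↦ (acc ++ b) ↾ |cap|`. [folklore] -/
noncomputable def coffOp : List Bool → List Bool :=
  (takeFn ∘ (fanoutFn (sndF ∘ sndF) (appF ∘ (fanoutFn fstF (fstF ∘ sndF)))))

/-- `coffOp ∈ FP`. [folklore] -/
theorem coffOp_mem_FP : coffOp ∈ FP :=
  (comp_mem_FP takeFn_mem_FP (fanoutFn_mem_FP (comp_mem_FP sndF_mem_FP sndF_mem_FP) (comp_mem_FP appF_mem_FP (fanoutFn_mem_FP fstF_mem_FP (comp_mem_FP fstF_mem_FP sndF_mem_FP)))))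

/-- The offset op keeps the state within the cap: `|coffOp w| ≤ |fstF w| + |sndF w|`. [folklore] -/
theorem length_coffOp_le (w : List Bool) : (coffOp w).length ≤ (fstF w).length + (sndF w).length + 0 := by
  rw [coffOp, Function.comp_apply, fanoutFn_apply, takeFn_boolPair]
  refine (List.length_take_le _ _).trans ?_
  simp only [Function.comp_apply]
  have := length_fstF_sndF_le (sndF w)
  omega

/-- Value of `coffOp`. [folklore] -/
theorem coffOp_apply (acc b cap : List Bool) : coffOp (boolPair acc (boolPair b cap)) = (acc ++ b).take cap.length := by
  simp [coffOp]

/-- **The coin offset of level `ℓ`** (capped at `|r|+1`): `Σ_{ℓ'<ℓ} blockLen(ℓ')`, on `⟨x, 1^ℓ⟩`. [folklore] -/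
noncomputable def coffFn : List Bool → List Bool :=
  (sndPow 2 ∘ (foldLoop coffOp (clipF 4 coffPiece) X ∘ (fanoutFn fstF (fanoutFn (lenBinF ∘ sndF) (fun _ => boolPair [] [])))))

/-- `coffFn ∈ FP`. [folklore] -/
theorem coffFn_mem_FP : coffFn ∈ FP :=
  (comp_mem_FP (sndPow_mem_FP 2) (comp_mem_FP (foldLoop_clipF_mem_FP (d := 0) 4 coffOp_mem_FP length_coffOp_le coffPiece_mem_FP X) (fanoutFn_mem_FP fstF_mem_FP (fanoutFn_mem_FP (comp_mem_FP lenBinF_mem_FP sndF_mem_FP) (const_mem_FP _)))))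


/-! ### Values of the bricks -/

section BrickValues

variable (n a b : ℕ) (r : List Bool) (ℓ : ℕ)

/-- Value of `nPrimeFn` (capped form). [folklore] -/
theorem nPrimeFn_apply_cap : nPrimeFn (lrnArg n a b r ℓ) = ones (capK n a b r.length ℓ * n + capK n a b r.length ℓ) := by
  obtain ⟨h1, h2, h3, h4, h5⟩ := lrnArg_fields n a b r ℓ
  simp only [nPrimeFn, Function.comp_apply, fanoutFn_apply, kFn_apply, h3, HashBricks.umulFn_boolPair, appF_boolPair,
    ones_append_ones, capK]

/-- Value of `qFn` (capped form). [folklore] -/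
theorem qFn_apply_cap : qFn (lrnArg n a b r ℓ) = ones (capQ n a b r.length ℓ) := by
  rw [qFn, Function.comp_apply, nPrimeFn_apply_cap, leastPrimeFn_apply, capQ]

/-- Value of `runLenFn`: the capped run length. [folklore] -/
theorem runLenFn_apply : runLenFn (lrnArg n a b r ℓ) = ones (capRunLen n a b r.length ℓ) := by
  obtain ⟨h1, h2, h3, h4, h5⟩ := lrnArg_fields n a b r ℓ
  simp only [runLenFn, Function.comp_apply, fanoutFn_apply, kFn_apply, bigLFn_apply, kkFn_apply, tFn_apply, kappaFn_apply,
    qFn_apply_cap, h1, h3, HashBricks.umulFn_boolPair, appF_boolPair, ones_append_ones, capRunLen, capK, capL, capT]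
  exact congrArg ones (by omega)

/-- Value of `blockLenFn`: the capped block length. [folklore] -/
theorem blockLenFn_apply : blockLenFn (lrnArg n a b r ℓ) = ones (capBlockLen n a b r.length ℓ) := by
  obtain ⟨h1, h2, h3, h4, h5⟩ := lrnArg_fields n a b r ℓ
  simp only [blockLenFn, Function.comp_apply, fanoutFn_apply, repsFn_apply, runLenFn_apply, mFn_apply, h3,
    HashBricks.umulFn_boolPair, appF_boolPair, ones_append_ones, capBlockLen, capReps]

/-- `take` of `ones`. [folklore] -/
theorem take_ones (c m : ℕ) : (ones m).take c = ones (min c m) := by rw [ones, List.take_replicate, ones]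

/-- Value of `coffPiece`. [folklore] -/
theorem coffPiece_apply : coffPiece (lrnArg n a b r ℓ) =
    boolPair (ones (min (capBlockLen n a b r.length ℓ) (r.length + 1))) (ones (r.length + 1)) := by
  obtain ⟨h1, h2, h3, h4, h5⟩ := lrnArg_fields n a b r ℓ
  have hcap : onesFn r ++ [true] = ones (r.length + 1) := by
    rw [onesFn_eq_ones, show [true] = ones 1 from rfl, ones_append_ones]
  rw [coffPiece, fanoutFn_apply]
  simp only [Function.comp_apply, fanoutFn_apply, h2, appF_boolPair, hcap, blockLenFn_apply, takeFn_boolPair, length_ones,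
    take_ones, Nat.min_comm]

/-- `min (min x c + min y c) c = min (x + y) c`. [folklore] -/
theorem min_add_min_min (x y c : ℕ) : min (min x c + min y c) c = min (x + y) c := by
  rcases le_total x c with hx | hx <;> rcases le_total y c with hy | hy <;>
    simp [hx, hy] <;> omega

/-- The offset fold after `j` rounds holds the capped partial sum. [folklore] -/
theorem foldAcc_coffOp (x : List Bool) (hx : ∀ j, coffPiece (boolPair x (ones j)) =
      boolPair (ones (min (capBlockLen n a b r.length j) (r.length + 1))) (ones (r.length + 1))) :
    ∀ j : ℕ, foldAcc coffOp coffPiece x 0 j [] =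
      ones (min (∑ ℓ' ∈ Finset.range j, capBlockLen n a b r.length ℓ') (r.length + 1))
  | 0 => by simp [ones]
  | j + 1 => by
    rw [foldAcc_succ', foldAcc_coffOp x hx j, zero_add, hx j, coffOp_apply, ones_append_ones, length_ones, take_ones,
      Nat.min_comm, min_add_min_min, Finset.sum_range_succ]

/-- **Value of `coffFn`**: the capped coin offset of level `ℓ ≤ |r| + 1`. [folklore] -/
theorem coffFn_apply (hℓ : ℓ ≤ r.length + 1) : coffFn (lrnArg n a b r ℓ) = ones (capCoff n a b r.length ℓ) := by
  obtain ⟨h1, h2, h3, h4, h5⟩ := lrnArg_fields n a b r ℓ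
  have hℓ' : ℓ ≤ X.eval (fstF (lrnArg n a b r ℓ)).length := by
    rw [eval_X, lrnArg, fstF_boolPair, length_boolPair]; omega
  rw [coffFn, Function.comp_apply, Function.comp_apply, fanoutFn_apply, fanoutFn_apply, Function.comp_apply, h1,
    lenBinF_apply, length_ones, show (boolPair ([] : List Bool) []) = boolPair (ones 0) ([] : List Bool) by rfl,
    foldLoop_apply _ _ hℓ']
  have hx : ∀ j, coffPiece (boolPair (fstF (lrnArg n a b r ℓ)) (ones j)) =
      boolPair (ones (min (capBlockLen n a b r.length j) (r.length + 1))) (ones (r.length + 1)) := by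
    intro j
    rw [show boolPair (fstF (lrnArg n a b r ℓ)) (ones j) = lrnArg n a b r j by rw [lrnArg, fstF_boolPair, lrnArg]]
    exact coffPiece_apply n a b r j
  rw [foldAcc_clipF (fun j _ _ => by
      rw [hx j, length_boolPair, length_ones, length_ones, lrnArg, fstF_boolPair, length_boolPair]
      have := min_le_right (capBlockLen n a b r.length j) (r.length + 1)
      omega), foldAcc_coffOp n a b r _ hx]
  simp only [sndPow, Function.comp_apply, sndF_boolPair, capCoff]

end BrickValues

/-! ### Queries -/

/-- `1^{L²k + k}`, the number of queries of one run, on `⟨x, 1^ℓ⟩`. [folklore] -/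
noncomputable def perRunFn : List Bool → List Bool :=
  (appF ∘ (fanoutFn (HashBricks.umulFn ∘ (fanoutFn (HashBricks.umulFn ∘ (fanoutFn bigLFn bigLFn)) kFn)) kFn))

/-- `perRunFn ∈ FP`. [folklore] -/
theorem perRunFn_mem_FP : perRunFn ∈ FP :=
  (comp_mem_FP appF_mem_FP (fanoutFn_mem_FP (comp_mem_FP HashBricks.umulFn_mem_FP (fanoutFn_mem_FP (comp_mem_FP HashBricks.umulFn_mem_FP (fanoutFn_mem_FP bigLFn_mem_FP bigLFn_mem_FP)) kFn_mem_FP)) kFn_mem_FP))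

/-- `1^{Reps·(L²k+k)}`, the number of run queries of the level, on `⟨x, 1^ℓ⟩`. [folklore] -/
noncomputable def runsQFn : List Bool → List Bool :=
  (HashBricks.umulFn ∘ (fanoutFn repsFn perRunFn))

/-- `runsQFn ∈ FP`. [folklore] -/
theorem runsQFn_mem_FP : runsQFn ∈ FP :=
  (comp_mem_FP HashBricks.umulFn_mem_FP (fanoutFn_mem_FP repsFn_mem_FP perRunFn_mem_FP))

/-- **Processedness of level `ℓ`**: `[coff(ℓ+1) ≤ |r|]`, on `⟨x, 1^ℓ⟩`. [folklore] -/
noncomputable def processedFn : List Bool → List Bool :=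
  (notFn (ltLenF ∘ fanoutFn (sndF ∘ fstF) (coffFn ∘ (fanoutFn fstF (appF ∘ (fanoutFn sndF (fun _ => [true])))))))

/-- `processedFn ∈ FP`. [folklore] -/
theorem processedFn_mem_FP : processedFn ∈ FP :=
  (notFn_mem_FP (comp_mem_FP ltLenF_mem_FP (fanoutFn_mem_FP (comp_mem_FP sndF_mem_FP fstF_mem_FP) (comp_mem_FP coffFn_mem_FP (fanoutFn_mem_FP fstF_mem_FP (comp_mem_FP appF_mem_FP (fanoutFn_mem_FP sndF_mem_FP (const_mem_FP _))))))))

/-- **The number of queries of level `ℓ`**: `1^{Reps(L²k+k) + m}` if processed, `ε` otherwise, on `⟨x, 1^ℓ⟩`. [folklore] -/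
noncomputable def nqFn : List Bool → List Bool :=
  (iteFn processedFn (appF ∘ (fanoutFn runsQFn mFn)) (fun _ => []))

/-- `nqFn ∈ FP`. [folklore] -/
theorem nqFn_mem_FP : nqFn ∈ FP :=
  (iteFn_mem_FP processedFn_mem_FP (comp_mem_FP appF_mem_FP (fanoutFn_mem_FP runsQFn_mem_FP mFn_mem_FP)) (const_mem_FP _))

/-- **The query of local index `u` at level `ℓ`**, on `⟨⟨x, 1^ℓ⟩, 1ᵘ⟩`: a table query (a block of a
pattern input), a trusted-tuple query, or a validation point.
[cite: CarmosinoImpagliazzoKabanetsKolokolova2016, §5 (complete algorithm, steps 2 and 5)] -/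
noncomputable def queryFn : List Bool → List Bool :=
  (iteFn (ltLenF ∘ (fanoutFn sndF (runsQFn ∘ fstF))) (iteFn (ltLenF ∘ (fanoutFn (sndF ∘ (divModFn ∘ (fanoutFn (perRunFn ∘ fstF) sndF))) (HashBricks.umulFn ∘ (fanoutFn (HashBricks.umulFn ∘ (fanoutFn (bigLFn ∘ fstF) (bigLFn ∘ fstF))) (kFn ∘ fstF))))) (blockFn ∘ (fanoutFn (fanoutFn (nthF 0 ∘ (fstF ∘ (fstF ∘ fstF))) (sndF ∘ (divModFn ∘ (fanoutFn (kFn ∘ fstF) (sndF ∘ (divModFn ∘ (fanoutFn (perRunFn ∘ fstF) sndF))))))) (patInputFn ∘ (fanoutFn (fanoutFn (fanoutFn (fanoutFn (fun _ => []) (fanoutFn (qFn ∘ fstF) (fanoutFn (sndF ∘ fstF) (fanoutFn (appF ∘ (fanoutFn (HashBricks.umulFn ∘ (fanoutFn (kFn ∘ fstF) (nthF 0 ∘ (fstF ∘ (fstF ∘ fstF))))) (kFn ∘ fstF))) (bigLFn ∘ fstF))))) (fanoutFn (takeFn ∘ (fanoutFn (sndF ∘ fstF) (takeFn ∘ (fanoutFn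 (runLenFn ∘ fstF) (dropFn ∘ (fanoutFn (appF ∘ (fanoutFn (coffFn ∘ fstF) (HashBricks.umulFn ∘ (fanoutFn (fstF ∘ (divModFn ∘ (fanoutFn (perRunFn ∘ fstF) sndF))) (runLenFn ∘ fstF))))) (sndF ∘ (fstF ∘ fstF)))))))) (fanoutFn (takeFn ∘ (fanoutFn (HashBricks.umulFn ∘ (fanoutFn (qFn ∘ fstF) (qFn ∘ fstF))) (dropFn ∘ (fanoutFn (sndF ∘ fstF) (takeFn ∘ (fanoutFn (runLenFn ∘ fstF) (dropFn ∘ (fanoutFn (appF ∘ (fanoutFn (coffFn ∘ fstF) (HashBricks.umulFn ∘ (fanoutFn (fstF ∘ (divModFn ∘ (fanoutFn (perRunFn ∘ fstF) sndF))) (runLenFn ∘ fstF))))) (sndF ∘ (fstF ∘ fstF)))))))))) (fanoutFn (nthF 0 ∘ (fstF ∘ (fstF ∘ fstF))) (kFn ∘ fstF))))) (fstF ∘ (divModFn ∘ (fanoutFn (HashBricks.umulFn ∘ (fanoutFn (bigLFn ∘ fstF) (kFn ∘ fstF))) (sndF ∘ (divModFn ∘ (fanoutFn (perRunFn ∘ fstF)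 sndF))))))) (sndF ∘ (divModFn ∘ (fanoutFn (bigLFn ∘ fstF) (fstF ∘ (divModFn ∘ (fanoutFn (kFn ∘ fstF) (sndF ∘ (divModFn ∘ (fanoutFn (perRunFn ∘ fstF) sndF))))))))))))) (takeFn ∘ (fanoutFn (nthF 0 ∘ (fstF ∘ (fstF ∘ fstF))) (dropFn ∘ (fanoutFn (appF ∘ (fanoutFn (appF ∘ (fanoutFn (sndF ∘ fstF) (appF ∘ (fanoutFn (HashBricks.umulFn ∘ (fanoutFn (qFn ∘ fstF) (qFn ∘ fstF))) (appF ∘ (fanoutFn (bigLFn ∘ fstF) (appF ∘ (fanoutFn (HashBricks.umulFn ∘ (fanoutFn (kkFn ∘ fstF) (kFn ∘ fstF))) (appF ∘ (fanoutFn (kkFn ∘ fstF) (kFn ∘ fstF))))))))))) (HashBricks.umulFn ∘ (fanoutFn (dropFn ∘ (fanoutFn (HashBricks.umulFn ∘ (fanoutFn (HashBricks.umulFn ∘ (fanoutFn (bigLFn ∘ fstF) (bigLFn ∘ fstF))) (kFn ∘ fstF))) (sndF ∘ (divModFn ∘ (fanoutFn (perRunFn ∘ fstF) sndF))))) (nthF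 0 ∘ (fstF ∘ (fstF ∘ fstF))))))) (takeFn ∘ (fanoutFn (runLenFn ∘ fstF) (dropFn ∘ (fanoutFn (appF ∘ (fanoutFn (coffFn ∘ fstF) (HashBricks.umulFn ∘ (fanoutFn (fstF ∘ (divModFn ∘ (fanoutFn (perRunFn ∘ fstF) sndF))) (runLenFn ∘ fstF))))) (sndF ∘ (fstF ∘ fstF))))))))))) (takeFn ∘ (fanoutFn (nthF 0 ∘ (fstF ∘ (fstF ∘ fstF))) (dropFn ∘ (fanoutFn (appF ∘ (fanoutFn (coffFn ∘ fstF) (appF ∘ (fanoutFn (HashBricks.umulFn ∘ (fanoutFn (repsFn ∘ fstF) (runLenFn ∘ fstF))) (HashBricks.umulFn ∘ (fanoutFn (dropFn ∘ (fanoutFn (runsQFn ∘ fstF) sndF)) (nthF 0 ∘ (fstF ∘ (fstF ∘ fstF))))))))) (sndF ∘ (fstF ∘ fstF)))))))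

/-- `queryFn ∈ FP`. [folklore] -/
theorem queryFn_mem_FP : queryFn ∈ FP :=
  (iteFn_mem_FP (comp_mem_FP ltLenF_mem_FP (fanoutFn_mem_FP sndF_mem_FP (comp_mem_FP runsQFn_mem_FP fstF_mem_FP))) (iteFn_mem_FP (comp_mem_FP ltLenF_mem_FP (fanoutFn_mem_FP (comp_mem_FP sndF_mem_FP (comp_mem_FP divModFn_mem_FP (fanoutFn_mem_FP (comp_mem_FP perRunFn_mem_FP fstF_mem_FP) sndF_mem_FP))) (comp_mem_FP HashBricks.umulFn_mem_FP (fanoutFn_mem_FP (comp_mem_FP HashBricks.umulFn_mem_FP (fanoutFn_mem_FP (comp_mem_FP bigLFn_mem_FP fstF_mem_FP) (comp_mem_FP bigLFn_mem_FP fstF_mem_FP))) (comp_mem_FP kFn_mem_FP fstF_mem_FP))))) (comp_mem_FP blockFn_mem_FP (fanoutFn_mem_FP (fanoutFn_mem_FP (comp_mem_FP (nthF_mem_FP 0) (comp_mem_FP fstF_mem_FP (comp_mem_FP fstF_mem_FP fstF_mem_FP))) (comp_mem_FP sndF_mem_FP (comp_mem_FP divModFn_mem_FP (fanoutFn_mem_FP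 (comp_mem_FP kFn_mem_FP fstF_mem_FP) (comp_mem_FP sndF_mem_FP (comp_mem_FP divModFn_mem_FP (fanoutFn_mem_FP (comp_mem_FP perRunFn_mem_FP fstF_mem_FP) sndF_mem_FP))))))) (comp_mem_FP patInputFn_mem_FP (fanoutFn_mem_FP (fanoutFn_mem_FP (fanoutFn_mem_FP (fanoutFn_mem_FP (const_mem_FP _) (fanoutFn_mem_FP (comp_mem_FP qFn_mem_FP fstF_mem_FP) (fanoutFn_mem_FP (comp_mem_FP sndF_mem_FP fstF_mem_FP) (fanoutFn_mem_FP (comp_mem_FP appF_mem_FP (fanoutFn_mem_FP (comp_mem_FP HashBricks.umulFn_mem_FP (fanoutFn_mem_FP (comp_mem_FP kFn_mem_FP fstF_mem_FP) (comp_mem_FP (nthF_mem_FP 0) (comp_mem_FP fstF_mem_FP (comp_mem_FP fstF_mem_FP fstF_mem_FP))))) (comp_mem_FP kFn_mem_FP fstF_mem_FP))) (comp_mem_FP bigLFn_mem_FP fstF_mem_FP))))) (fanoutFn_mem_FP (comp_mem_FP takeFn_mem_FP (fanoutFn_mem_FP (comp_mem_FP sndF_mem_FP fstF_mem_FP) (comp_mem_FP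 takeFn_mem_FP (fanoutFn_mem_FP (comp_mem_FP runLenFn_mem_FP fstF_mem_FP) (comp_mem_FP dropFn_mem_FP (fanoutFn_mem_FP (comp_mem_FP appF_mem_FP (fanoutFn_mem_FP (comp_mem_FP coffFn_mem_FP fstF_mem_FP) (comp_mem_FP HashBricks.umulFn_mem_FP (fanoutFn_mem_FP (comp_mem_FP fstF_mem_FP (comp_mem_FP divModFn_mem_FP (fanoutFn_mem_FP (comp_mem_FP perRunFn_mem_FP fstF_mem_FP) sndF_mem_FP))) (comp_mem_FP runLenFn_mem_FP fstF_mem_FP))))) (comp_mem_FP sndF_mem_FP (comp_mem_FP fstF_mem_FP fstF_mem_FP)))))))) (fanoutFn_mem_FP (comp_mem_FP takeFn_mem_FP (fanoutFn_mem_FP (comp_mem_FP HashBricks.umulFn_mem_FP (fanoutFn_mem_FP (comp_mem_FP qFn_mem_FP fstF_mem_FP) (comp_mem_FP qFn_mem_FP fstF_mem_FP))) (comp_mem_FP dropFn_mem_FP (fanoutFn_mem_FP (comp_mem_FP sndF_mem_FP fstF_mem_FP) (comp_mem_FP takeFn_mem_FP (fanoutFn_mem_FP (comp_mem_FP runLenFn_mem_FP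 fstF_mem_FP) (comp_mem_FP dropFn_mem_FP (fanoutFn_mem_FP (comp_mem_FP appF_mem_FP (fanoutFn_mem_FP (comp_mem_FP coffFn_mem_FP fstF_mem_FP) (comp_mem_FP HashBricks.umulFn_mem_FP (fanoutFn_mem_FP (comp_mem_FP fstF_mem_FP (comp_mem_FP divModFn_mem_FP (fanoutFn_mem_FP (comp_mem_FP perRunFn_mem_FP fstF_mem_FP) sndF_mem_FP))) (comp_mem_FP runLenFn_mem_FP fstF_mem_FP))))) (comp_mem_FP sndF_mem_FP (comp_mem_FP fstF_mem_FP fstF_mem_FP)))))))))) (fanoutFn_mem_FP (comp_mem_FP (nthF_mem_FP 0) (comp_mem_FP fstF_mem_FP (comp_mem_FP fstF_mem_FP fstF_mem_FP))) (comp_mem_FP kFn_mem_FP fstF_mem_FP))))) (comp_mem_FP fstF_mem_FP (comp_mem_FP divModFn_mem_FP (fanoutFn_mem_FP (comp_mem_FP HashBricks.umulFn_mem_FP (fanoutFn_mem_FP (comp_mem_FP bigLFn_mem_FP fstF_mem_FP) (comp_mem_FP kFn_mem_FP fstF_mem_FP))) (comp_mem_FP sndF_mem_FP (comp_mem_FP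 divModFn_mem_FP (fanoutFn_mem_FP (comp_mem_FP perRunFn_mem_FP fstF_mem_FP) sndF_mem_FP))))))) (comp_mem_FP sndF_mem_FP (comp_mem_FP divModFn_mem_FP (fanoutFn_mem_FP (comp_mem_FP bigLFn_mem_FP fstF_mem_FP) (comp_mem_FP fstF_mem_FP (comp_mem_FP divModFn_mem_FP (fanoutFn_mem_FP (comp_mem_FP kFn_mem_FP fstF_mem_FP) (comp_mem_FP sndF_mem_FP (comp_mem_FP divModFn_mem_FP (fanoutFn_mem_FP (comp_mem_FP perRunFn_mem_FP fstF_mem_FP) sndF_mem_FP))))))))))))) (comp_mem_FP takeFn_mem_FP (fanoutFn_mem_FP (comp_mem_FP (nthF_mem_FP 0) (comp_mem_FP fstF_mem_FP (comp_mem_FP fstF_mem_FP fstF_mem_FP))) (comp_mem_FP dropFn_mem_FP (fanoutFn_mem_FP (comp_mem_FP appF_mem_FP (fanoutFn_mem_FP (comp_mem_FP appF_mem_FP (fanoutFn_mem_FP (comp_mem_FP sndF_mem_FP fstF_mem_FP) (comp_mem_FP appF_mem_FP (fanoutFn_mem_FP (comp_mem_FP HashBricks.umulFn_mem_FP (fanoutFn_mem_FP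 (comp_mem_FP qFn_mem_FP fstF_mem_FP) (comp_mem_FP qFn_mem_FP fstF_mem_FP))) (comp_mem_FP appF_mem_FP (fanoutFn_mem_FP (comp_mem_FP bigLFn_mem_FP fstF_mem_FP) (comp_mem_FP appF_mem_FP (fanoutFn_mem_FP (comp_mem_FP HashBricks.umulFn_mem_FP (fanoutFn_mem_FP (comp_mem_FP kkFn_mem_FP fstF_mem_FP) (comp_mem_FP kFn_mem_FP fstF_mem_FP))) (comp_mem_FP appF_mem_FP (fanoutFn_mem_FP (comp_mem_FP kkFn_mem_FP fstF_mem_FP) (comp_mem_FP kFn_mem_FP fstF_mem_FP))))))))))) (comp_mem_FP HashBricks.umulFn_mem_FP (fanoutFn_mem_FP (comp_mem_FP dropFn_mem_FP (fanoutFn_mem_FP (comp_mem_FP HashBricks.umulFn_mem_FP (fanoutFn_mem_FP (comp_mem_FP HashBricks.umulFn_mem_FP (fanoutFn_mem_FP (comp_mem_FP bigLFn_mem_FP fstF_mem_FP) (comp_mem_FP bigLFn_mem_FP fstF_mem_FP))) (comp_mem_FP kFn_mem_FP fstF_mem_FP))) (comp_mem_FP sndF_mem_FP (comp_mem_FP divModFn_mem_FP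 (fanoutFn_mem_FP (comp_mem_FP perRunFn_mem_FP fstF_mem_FP) sndF_mem_FP))))) (comp_mem_FP (nthF_mem_FP 0) (comp_mem_FP fstF_mem_FP (comp_mem_FP fstF_mem_FP fstF_mem_FP))))))) (comp_mem_FP takeFn_mem_FP (fanoutFn_mem_FP (comp_mem_FP runLenFn_mem_FP fstF_mem_FP) (comp_mem_FP dropFn_mem_FP (fanoutFn_mem_FP (comp_mem_FP appF_mem_FP (fanoutFn_mem_FP (comp_mem_FP coffFn_mem_FP fstF_mem_FP) (comp_mem_FP HashBricks.umulFn_mem_FP (fanoutFn_mem_FP (comp_mem_FP fstF_mem_FP (comp_mem_FP divModFn_mem_FP (fanoutFn_mem_FP (comp_mem_FP perRunFn_mem_FP fstF_mem_FP) sndF_mem_FP))) (comp_mem_FP runLenFn_mem_FP fstF_mem_FP))))) (comp_mem_FP sndF_mem_FP (comp_mem_FP fstF_mem_FP fstF_mem_FP))))))))))) (comp_mem_FP takeFn_mem_FP (fanoutFn_mem_FP (comp_mem_FP (nthF_mem_FP 0) (comp_mem_FP fstF_mem_FP (comp_mem_FP fstF_mem_FP fstF_mem_FP))) (comp_mem_FP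 dropFn_mem_FP (fanoutFn_mem_FP (comp_mem_FP appF_mem_FP (fanoutFn_mem_FP (comp_mem_FP coffFn_mem_FP fstF_mem_FP) (comp_mem_FP appF_mem_FP (fanoutFn_mem_FP (comp_mem_FP HashBricks.umulFn_mem_FP (fanoutFn_mem_FP (comp_mem_FP repsFn_mem_FP fstF_mem_FP) (comp_mem_FP runLenFn_mem_FP fstF_mem_FP))) (comp_mem_FP HashBricks.umulFn_mem_FP (fanoutFn_mem_FP (comp_mem_FP dropFn_mem_FP (fanoutFn_mem_FP (comp_mem_FP runsQFn_mem_FP fstF_mem_FP) sndF_mem_FP)) (comp_mem_FP (nthF_mem_FP 0) (comp_mem_FP fstF_mem_FP (comp_mem_FP fstF_mem_FP fstF_mem_FP))))))))) (comp_mem_FP sndF_mem_FP (comp_mem_FP fstF_mem_FP fstF_mem_FP)))))))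

/-! ### The query schedule (plain functions) and the values of the query bricks -/

section QueryValues

variable (n a b : ℕ) (r : List Bool) (ℓ : ℕ)

/-- `q` at level `ℓ` is prime. [folklore] -/
instance lvlQ_prime : Fact (lvlQ n a b ℓ).Prime := ⟨(prmQ_spec _).2⟩

/-- `kn + k ≤ q` at level `ℓ`. [folklore] -/
theorem lvl_hn : lvlK n a b ℓ * n + lvlK n a b ℓ ≤ lvlQ n a b ℓ := (prmQ_spec _).1

/-- `0 < k`. [folklore] -/
theorem lvlK_pos : 0 < lvlK n a b ℓ := Nat.two_pow_pos _

/-- `2^κ ≤ k` (indeed `=`). [folklore] -/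
theorem two_pow_kappa_le_lvlK : 2 ^ prmKappa (prmS n a b) ℓ ≤ lvlK n a b ℓ := le_of_eq rfl

/-- The number of queries of one run: `L²k + k`. [folklore] -/
def lvlPerRun : ℕ := 2 ^ ℓ * 2 ^ ℓ * lvlK n a b ℓ + lvlK n a b ℓ

/-- The number of queries of level `ℓ` (`0` if not processed). [folklore] -/
noncomputable def lvlNQ : ℕ :=
  if LvlProcessed n a b r.length ℓ then prmReps (prmS n a b) ℓ * lvlPerRun n a b ℓ + prmM (prmS n a b) ℓ else 0

/-- The coin segment of run `ρ` of level `ℓ`. [folklore] -/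
def lvlSeg (ρ : ℕ) : List Bool := slice r (lvlCoff n a b ℓ + ρ * lvlRunLen n a b ℓ) (lvlRunLen n a b ℓ)

/-- The run coins of run `ρ` of level `ℓ`. [folklore] -/
noncomputable def lvlCoins (ρ : ℕ) : RunCoins n (lvlK n a b ℓ) (2 ^ ℓ) (lvlQ n a b ℓ * lvlQ n a b ℓ) (prmKK (prmS n a b) ℓ) (prmT (prmS n a b) ℓ) :=
  coinsToRun n (lvlK n a b ℓ) ℓ (prmKK (prmS n a b) ℓ) (prmT (prmS n a b) ℓ) (lvlQ n a b ℓ) (prmKappa (prmS n a b) ℓ)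
    (lvlK_pos n a b ℓ) (lvlSeg n a b r ℓ ρ)

/-- Validation point `w` of level `ℓ`. [folklore] -/
def lvlValPt (w : ℕ) : Fin n → Bool :=
  readBits r (lvlCoff n a b ℓ + prmReps (prmS n a b) ℓ * lvlRunLen n a b ℓ + w * n) n

/-- **The query of local index `u` at level `ℓ`.** [cite: CarmosinoImpagliazzoKabanetsKolokolova2016, §5] -/
noncomputable def lvlQuery (u : ℕ) : Fin n → Bool :=
  if u < prmReps (prmS n a b) ℓ * lvlPerRun n a b ℓ then
    let ρ := u / lvlPerRun n a b ℓ
    let v := u % lvlPerRun n a b ℓ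
    if hv : v < 2 ^ ℓ * 2 ^ ℓ * lvlK n a b ℓ then
      let j := v / (2 ^ ℓ * lvlK n a b ℓ)
      let c := v / lvlK n a b ℓ % 2 ^ ℓ
      let blk := v % lvlK n a b ℓ
      fun d => patInput (lvlQ n a b ℓ) ℓ (learnerDesign (lvlQ n a b ℓ) n (lvlK n a b ℓ) ℓ (lvl_hn n a b ℓ))
        (lvlCoins n a b r ℓ ρ).1.1 ⟨j, Nat.div_lt_of_lt_mul (by
          rw [mul_comm, ← mul_assoc]; exact hv)⟩ (lvlCoins n a b r ℓ ρ).1.2.1 c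
        (ampIdxEquiv n (lvlK n a b ℓ) (Sum.inl (⟨blk, Nat.mod_lt _ (lvlK_pos n a b ℓ)⟩, d)))
    else (lvlCoins n a b r ℓ ρ).2.2.2.1 ⟨(v - 2 ^ ℓ * 2 ^ ℓ * lvlK n a b ℓ) % lvlK n a b ℓ, Nat.mod_lt _ (lvlK_pos n a b ℓ)⟩
  else lvlValPt n a b r ℓ (u - prmReps (prmS n a b) ℓ * lvlPerRun n a b ℓ)

variable {n a b r ℓ}

/-- A processed level has at least one coin. [folklore] -/
theorem one_le_length_of_processed (h : LvlProcessed n a b r.length ℓ) : 1 ≤ r.length := by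
  rw [LvlProcessed, lvlCoff, Finset.sum_range_succ] at h
  have : 1 ≤ lvlBlockLen n a b ℓ := by
    rw [lvlBlockLen, lvlRunLen, runLen, offSt, offA, offPb, offSg, offSd, offW]
    have h1 : 1 ≤ prmReps (prmS n a b) ℓ := Nat.one_le_two_pow
    have h2 := prmKK_ge (prmS n a b) ℓ
    have h3 : prmKK (prmS n a b) ℓ ≤ ℓ + lvlQ n a b ℓ * lvlQ n a b ℓ + 2 ^ ℓ + prmKK (prmS n a b) ℓ * lvlK n a b ℓ +
        prmKK (prmS n a b) ℓ + lvlK n a b ℓ + lvlK n a b ℓ * n +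
        prmT (prmS n a b) ℓ * stepLen n (lvlK n a b ℓ) (prmKappa (prmS n a b) ℓ) := by
      generalize 2 ^ ℓ = L
      omega
    calc 1 ≤ 1 * prmKK (prmS n a b) ℓ := by omega
      _ ≤ _ := (Nat.mul_le_mul h1 h3).trans (Nat.le_add_right _ _)
  omega

/-- **On a processed level all capped parameters are exact.** [folklore] -/
theorem capsExact_of_processed (h : LvlProcessed n a b r.length ℓ) : CapsExact n a b r.length ℓ :=
  (capCoff_spec (one_le_length_of_processed h) (ℓ + 1)
    ((capCoff_succ_le_iff (one_le_length_of_processed h) ℓ).2 h)).1 ℓ (Nat.lt_succ_self ℓ)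

/-- `capCoff` is monotone in the level. [folklore] -/
theorem capCoff_mono {R ℓ ℓ' : ℕ} (h : ℓ ≤ ℓ') : capCoff n a b R ℓ ≤ capCoff n a b R ℓ' :=
  min_le_min_right _ (Finset.sum_le_sum_of_subset (Finset.range_mono h))

/-- On a processed level the capped offset is the true offset. [folklore] -/
theorem capCoff_eq_of_processed (h : LvlProcessed n a b r.length ℓ) : capCoff n a b r.length ℓ = lvlCoff n a b ℓ :=
  capCoff_eq_lvlCoff (one_le_length_of_processed h)
    ((capCoff_mono (Nat.le_succ ℓ)).trans ((capCoff_succ_le_iff (one_le_length_of_processed h) ℓ).2 h))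

/-- `ℓ < 2^ℓ ≤ |r|` on a processed level. [folklore] -/
theorem lt_length_of_processed (h : LvlProcessed n a b r.length ℓ) : ℓ < r.length :=
  lt_of_lt_of_le (Nat.lt_two_pow_self) (capsExact_of_processed h).2.1

/-- **The parameter bricks are exact on a processed level.** [folklore] -/
theorem bricks_of_processed (h : LvlProcessed n a b r.length ℓ) :
    kFn (lrnArg n a b r ℓ) = ones (lvlK n a b ℓ) ∧ bigLFn (lrnArg n a b r ℓ) = ones (2 ^ ℓ) ∧
      tFn (lrnArg n a b r ℓ) = ones (prmT (prmS n a b) ℓ) ∧ repsFn (lrnArg n a b r ℓ) = ones (prmReps (prmS n a b) ℓ) ∧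
      qFn (lrnArg n a b r ℓ) = ones (lvlQ n a b ℓ) ∧ runLenFn (lrnArg n a b r ℓ) = ones (lvlRunLen n a b ℓ) ∧
      coffFn (lrnArg n a b r ℓ) = ones (lvlCoff n a b ℓ) ∧ perRunFn (lrnArg n a b r ℓ) = ones (lvlPerRun n a b ℓ) ∧
      bigKKFn (lrnArg n a b r ℓ) = ones (2 ^ prmKK (prmS n a b) ℓ) := by
  have hc := capsExact_of_processed h
  obtain ⟨hk, hL, hT, hReps, hq, hrl, -⟩ := cap_eq_of_capsExact hc
  have hk' : min (prmK (prmS n a b) ℓ) r.length = lvlK n a b ℓ := hk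
  have hL' : min (2 ^ ℓ) r.length = 2 ^ ℓ := hL
  have hT' : min (prmT (prmS n a b) ℓ) r.length = prmT (prmS n a b) ℓ := hT
  have hReps' : min (prmReps (prmS n a b) ℓ) r.length = prmReps (prmS n a b) ℓ := hReps
  have hKK : 2 ^ prmKK (prmS n a b) ℓ ≤ r.length := by
    refine le_trans (Nat.pow_le_pow_right (by norm_num) ?_) hc.2.2.2
    rw [prmKK]; omega
  refine ⟨by rw [kFn_apply, hk'], by rw [bigLFn_apply, hL'], by rw [tFn_apply, hT'],
    by rw [repsFn_apply, hReps'], by rw [qFn_apply_cap, hq], by rw [runLenFn_apply, hrl],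
    by rw [coffFn_apply n a b r ℓ ((lt_length_of_processed h).le.trans (Nat.le_succ _)), capCoff_eq_of_processed h], ?_,
    by rw [bigKKFn_apply, min_eq_left hKK]⟩
  obtain ⟨h1, h2, h3, h4, h5⟩ := lrnArg_fields n a b r ℓ
  simp only [perRunFn, Function.comp_apply, fanoutFn_apply, kFn_apply, bigLFn_apply, HashBricks.umulFn_boolPair, appF_boolPair,
    ones_append_ones, lvlPerRun, hk', hL']

/-- The coin segment of a run `ρ < Reps` of a processed level lies inside the coins. [folklore] -/
theorem seg_fits (h : LvlProcessed n a b r.length ℓ) {ρ : ℕ} (hρ : ρ < prmReps (prmS n a b) ℓ) :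
    lvlCoff n a b ℓ + ρ * lvlRunLen n a b ℓ + lvlRunLen n a b ℓ ≤ r.length := by
  rw [LvlProcessed, lvlCoff, Finset.sum_range_succ, ← lvlCoff, lvlBlockLen] at h
  have : (ρ + 1) * lvlRunLen n a b ℓ ≤ prmReps (prmS n a b) ℓ * lvlRunLen n a b ℓ := Nat.mul_le_mul_right _ hρ
  rw [Nat.succ_mul] at this
  omega

/-- The validation point `w < m` of a processed level lies inside the coins. [folklore] -/
theorem valPt_fits (h : LvlProcessed n a b r.length ℓ) {w : ℕ} (hw : w < prmM (prmS n a b) ℓ) :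
    lvlCoff n a b ℓ + prmReps (prmS n a b) ℓ * lvlRunLen n a b ℓ + w * n + n ≤ r.length := by
  rw [LvlProcessed, lvlCoff, Finset.sum_range_succ, ← lvlCoff, lvlBlockLen] at h
  have : (w + 1) * n ≤ prmM (prmS n a b) ℓ * n := Nat.mul_le_mul_right _ hw
  rw [Nat.succ_mul] at this
  omega

/-- The length of a run segment. [folklore] -/
theorem length_lvlSeg (h : LvlProcessed n a b r.length ℓ) {ρ : ℕ} (hρ : ρ < prmReps (prmS n a b) ℓ) :
    (lvlSeg n a b r ℓ ρ).length = lvlRunLen n a b ℓ := length_slice (seg_fits h hρ)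

/-- The table context of a run read off its segment is the genuine `tblCtx`. [folklore] -/
theorem tblCtx_of_seg (h : LvlProcessed n a b r.length ℓ) {ρ : ℕ} (hρ : ρ < prmReps (prmS n a b) ℓ) :
    boolPair (boolPair [] (boolPair (ones (lvlQ n a b ℓ)) (boolPair (ones ℓ) (boolPair (ones (lvlK n a b ℓ * n + lvlK n a b ℓ)) (ones (2 ^ ℓ))))))
      (boolPair ((lvlSeg n a b r ℓ ρ).take ℓ) (boolPair (((lvlSeg n a b r ℓ ρ).drop ℓ).take (lvlQ n a b ℓ * lvlQ n a b ℓ))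
        (boolPair (ones n) (ones (lvlK n a b ℓ))))) =
      tblCtx (lvlQ n a b ℓ) n (lvlK n a b ℓ) ℓ (List.ofFn ((boolFunEquivFin ℓ).symm (lvlCoins n a b r ℓ ρ).1.1))
        (List.ofFn (lvlCoins n a b r ℓ ρ).1.2.1) := by
  have hlen := length_lvlSeg h hρ
  have hrl : ℓ + lvlQ n a b ℓ * lvlQ n a b ℓ ≤ lvlRunLen n a b ℓ := by
    rw [lvlRunLen, runLen, offSt, offA, offPb, offSg, offSd, offW]; generalize 2 ^ ℓ = L; omega
  rw [tblCtx, predHdr, lvlCoins, coinsToRun]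
  dsimp only
  rw [Equiv.symm_apply_apply, ← drop_take_eq_ofFn_readBits _ (by omega), ← drop_take_eq_ofFn_readBits _ (by omega),
    List.drop_zero]

/-- `drop` of `ones`. [folklore] -/
theorem drop_ones (c m : ℕ) : (ones m).drop c = ones (m - c) := by rw [ones, List.drop_replicate, ones]

/-- A one-bit condition `[decide p] = [true]`. [folklore] -/
theorem singleton_decide_eq_iff (p : Prop) [Decidable p] : ([decide p] = [true]) ↔ p := by simp

/-- Value of `runsQFn` on a processed level. [folklore] -/
theorem runsQFn_apply (h : LvlProcessed n a b r.length ℓ) :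
    runsQFn (lrnArg n a b r ℓ) = ones (prmReps (prmS n a b) ℓ * lvlPerRun n a b ℓ) := by
  obtain ⟨hk, hL, hT, hReps, hq, hrl, hcoff, hper, -⟩ := bricks_of_processed h
  simp only [runsQFn, Function.comp_apply, fanoutFn_apply, hReps, hper, HashBricks.umulFn_boolPair]

/-- Reading inside a slice. [folklore] -/
theorem getD_slice {seg : List Bool} {o len p : ℕ} (hp : p < len) :
    (slice seg o len).getD p false = seg.getD (o + p) false := by
  rw [slice, List.getD_eq_getElem?_getD, List.getD_eq_getElem?_getD, List.getElem?_take_of_lt hp, List.getElem?_drop]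

/-- **Value of `queryFn`** on a processed level: the scheduled query `lvlQuery`.
[cite: CarmosinoImpagliazzoKabanetsKolokolova2016, §5 (complete algorithm)] -/
theorem queryFn_apply (h : LvlProcessed n a b r.length ℓ) {u : ℕ}
    (hu : u < prmReps (prmS n a b) ℓ * lvlPerRun n a b ℓ + prmM (prmS n a b) ℓ) :
    queryFn (boolPair (lrnArg n a b r ℓ) (ones u)) = List.ofFn (lvlQuery n a b r ℓ u) := by
  obtain ⟨hk, hL, hT, hReps, hq, hrl, hcoff, hper, -⟩ := bricks_of_processed h
  obtain ⟨h1, h2, h3, h4, h5⟩ := lrnArg_fields n a b r ℓ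
  have hkk := kkFn_apply n a b r ℓ
  have hkpos := lvlK_pos n a b ℓ
  have hrunsQ := runsQFn_apply h
  have hPERpos : 0 < lvlPerRun n a b ℓ := Nat.add_pos_right _ hkpos
  rw [queryFn]
  simp only [iteFn_of_oneBit (oneBit_ltLenF.comp _), Function.comp_apply, fanoutFn_apply, fstF_boolPair, sndF_boolPair,
    h1, h2, h3, hk, hL, hReps, hq, hrl, hcoff, hper, hkk, hrunsQ, ltLenF_boolPair, length_ones, singleton_decide_eq_iff,
    HashBricks.umulFn_boolPair, appF_boolPair, ones_append_ones, divModFn_boolPair, takeFn_boolPair, dropFn_boolPair,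
    drop_ones]
  rw [lvlQuery]
  dsimp only
  by_cases hrun : u < prmReps (prmS n a b) ℓ * lvlPerRun n a b ℓ
  · rw [if_pos hrun, if_pos hrun]
    have hρ : u / lvlPerRun n a b ℓ < prmReps (prmS n a b) ℓ := Nat.div_lt_of_lt_mul (by rwa [mul_comm] at hrun)
    have hseg : List.take (lvlRunLen n a b ℓ) (List.drop (lvlCoff n a b ℓ + u / lvlPerRun n a b ℓ * lvlRunLen n a b ℓ) r) =
        lvlSeg n a b r ℓ (u / lvlPerRun n a b ℓ) := rfl
    rw [hseg]
    by_cases htab : u % lvlPerRun n a b ℓ < 2 ^ ℓ * 2 ^ ℓ * lvlK n a b ℓ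
    · have hj : u % lvlPerRun n a b ℓ / (2 ^ ℓ * lvlK n a b ℓ) < 2 ^ ℓ :=
        Nat.div_lt_of_lt_mul (by rw [mul_comm, ← mul_assoc]; exact htab)
      rw [if_pos htab, dif_pos htab, tblCtx_of_seg h hρ, patInputFn_apply (lvl_hn n a b ℓ) _ _ hj,
        blockFn_ofFn _ ⟨u % lvlPerRun n a b ℓ % lvlK n a b ℓ, Nat.mod_lt _ hkpos⟩]
    · rw [if_neg htab, dif_neg htab]
      have hlen := length_lvlSeg h hρ
      have hblk : u % lvlPerRun n a b ℓ - 2 ^ ℓ * 2 ^ ℓ * lvlK n a b ℓ < lvlK n a b ℓ := by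
        have := Nat.mod_lt u hPERpos
        rw [lvlPerRun] at this ⊢
        omega
      have hbn : (u % lvlPerRun n a b ℓ - 2 ^ ℓ * 2 ^ ℓ * lvlK n a b ℓ) * n + n ≤ lvlK n a b ℓ * n := by
        have := Nat.mul_le_mul_right n hblk
        rw [Nat.succ_mul] at this; exact this
      have hfit : ℓ + (lvlQ n a b ℓ * lvlQ n a b ℓ + (2 ^ ℓ + (prmKK (prmS n a b) ℓ * lvlK n a b ℓ +
          (prmKK (prmS n a b) ℓ + lvlK n a b ℓ)))) + (u % lvlPerRun n a b ℓ - 2 ^ ℓ * 2 ^ ℓ * lvlK n a b ℓ) * n + n ≤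
          (lvlSeg n a b r ℓ (u / lvlPerRun n a b ℓ)).length := by
        rw [hlen, lvlRunLen, runLen, offSt, offA, offPb, offSg, offSd, offW]
        generalize 2 ^ ℓ = L at *
        omega
      rw [drop_take_eq_ofFn_readBits _ hfit]
      refine congrArg List.ofFn (funext fun d => ?_)
      rw [lvlCoins, coinsToRun]
      dsimp only
      have hdn : (u % lvlPerRun n a b ℓ - 2 ^ ℓ * 2 ^ ℓ * lvlK n a b ℓ) * n + d < lvlK n a b ℓ * n := by
        have := d.isLt; omega
      rw [Nat.mod_eq_of_lt hblk, readBits, getD_slice hdn, offA, offPb, offSg, offSd, offW]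
      exact congrArg (fun o => (lvlSeg n a b r ℓ (u / lvlPerRun n a b ℓ)).getD o false) (by ring)
  · rw [if_neg hrun, if_neg hrun, lvlValPt]
    have hw : u - prmReps (prmS n a b) ℓ * lvlPerRun n a b ℓ < prmM (prmS n a b) ℓ := by omega
    have := valPt_fits h hw
    rw [drop_take_eq_ofFn_readBits _ (by omega), Nat.add_assoc]

end QueryValues

/-- **The op of the query-search fold** on `⟨S, z⟩`, `S = ⟨rem, ⟨flag, y⟩⟩`, `z = ⟨x, 1^{ℓ'}⟩`: once the
answer is set keep it; otherwise answer at this level if `rem < nq(ℓ')`, else subtract `nq(ℓ')`. [folklore] -/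
noncomputable def qOp : List Bool → List Bool :=
  (iteFn (isNilFn ∘ (fstF ∘ (sndF ∘ fstF))) (iteFn (ltLenF ∘ (fanoutFn (fstF ∘ fstF) (nqFn ∘ sndF))) (fanoutFn (fstF ∘ fstF) (fanoutFn (fun _ => [true]) (queryFn ∘ (fanoutFn sndF (fstF ∘ fstF))))) (fanoutFn (dropFn ∘ (fanoutFn (nqFn ∘ sndF) (fstF ∘ fstF))) (fun _ => boolPair [] []))) fstF)

/-- `qOp ∈ FP`. [folklore] -/
theorem qOp_mem_FP : qOp ∈ FP :=
  (iteFn_mem_FP (comp_mem_FP isNilFn_mem_FP (comp_mem_FP fstF_mem_FP (comp_mem_FP sndF_mem_FP fstF_mem_FP))) (iteFn_mem_FP (comp_mem_FP ltLenF_mem_FP (fanoutFn_mem_FP (comp_mem_FP fstF_mem_FP fstF_mem_FP) (comp_mem_FP nqFn_mem_FP sndF_mem_FP))) (fanoutFn_mem_FP (comp_mem_FP fstF_mem_FP fstF_mem_FP) (fanoutFn_mem_FP (const_mem_FP _) (comp_mem_FP queryFn_mem_FP (fanoutFn_mem_FP sndF_mem_FP (comp_mem_FP fstF_mem_FP fstF_mem_FP)))))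 (fanoutFn_mem_FP (comp_mem_FP dropFn_mem_FP (fanoutFn_mem_FP (comp_mem_FP nqFn_mem_FP sndF_mem_FP) (comp_mem_FP fstF_mem_FP fstF_mem_FP))) (const_mem_FP _))) fstF_mem_FP)

/-- The piece of the query-search fold on `⟨x', 1^{ℓ'}⟩`, `x' = ⟨x, 1^{idx}⟩`: the level argument `⟨x, 1^{ℓ'}⟩`. [folklore] -/
noncomputable def qPiece : List Bool → List Bool :=
  (fanoutFn (fstF ∘ fstF) sndF)

/-- `qPiece ∈ FP`. [folklore] -/
theorem qPiece_mem_FP : qPiece ∈ FP :=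
  (fanoutFn_mem_FP (comp_mem_FP fstF_mem_FP fstF_mem_FP) sndF_mem_FP)

/-! ### The query function of the learner -/

section QFn

variable {n a b : ℕ} {r : List Bool} {ℓ : ℕ}

/-- Value of `processedFn` (`ℓ ≤ |r|`, `|r| ≥ 1`). [folklore] -/
theorem processedFn_apply (n a b : ℕ) (r : List Bool) (hR : 1 ≤ r.length) {ℓ : ℕ} (hℓ : ℓ ≤ r.length) :
    processedFn (lrnArg n a b r ℓ) = [decide (LvlProcessed n a b r.length ℓ)] := by
  obtain ⟨h1, h2, h3, h4, h5⟩ := lrnArg_fields n a b r ℓ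
  have hsucc : boolPair (fstF (lrnArg n a b r ℓ)) (ones ℓ ++ [true]) = lrnArg n a b r (ℓ + 1) := by
    rw [lrnArg, fstF_boolPair, lrnArg, show [true] = ones 1 from rfl, ones_append_ones]
  have hiff := capCoff_succ_le_iff (n := n) (a := a) (b := b) hR ℓ
  rw [processedFn, notFn_apply (b := decide (r.length < capCoff n a b r.length (ℓ + 1)))]
  · simp only [List.cons.injEq, and_true]
    by_cases h : capCoff n a b r.length (ℓ + 1) ≤ r.length
    · rw [decide_eq_true (hiff.1 h), decide_eq_false (not_lt.2 h)]; rfl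
    · rw [decide_eq_false (fun hp => h (hiff.2 hp)), decide_eq_true (not_le.1 h)]; rfl
  · rw [Function.comp_apply, fanoutFn_apply, Function.comp_apply, Function.comp_apply, fanoutFn_apply]
    simp only [Function.comp_apply, fanoutFn_apply, h1, h2, appF_boolPair, hsucc, coffFn_apply n a b r (ℓ + 1) (by omega),
      ltLenF_boolPair, length_ones]

/-- Value of `nqFn` (`ℓ ≤ |r|`, `|r| ≥ 1`): `1^{lvlNQ}`. [folklore] -/
theorem nqFn_apply (n a b : ℕ) (r : List Bool) (hR : 1 ≤ r.length) {ℓ : ℕ} (hℓ : ℓ ≤ r.length) :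
    nqFn (lrnArg n a b r ℓ) = ones (lvlNQ n a b r ℓ) := by
  rw [nqFn, iteFn_apply (processedFn_apply n a b r hR hℓ), lvlNQ]
  by_cases h : LvlProcessed n a b r.length ℓ
  · rw [decide_eq_true h, if_pos h]
    simp only [ite_true, Function.comp_apply, fanoutFn_apply, runsQFn_apply h, mFn_apply, appF_boolPair, ones_append_ones]
  · rw [decide_eq_false h, if_neg h]; rfl

/-- The query brick's output is never longer than its level argument. [folklore] -/
theorem length_queryFn_le (w : List Bool) : (queryFn w).length ≤ (fstF w).length := by
  have hn : (nthF 0 (fstF (fstF (fstF w)))).length ≤ (fstF w).length := by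
    have a1 := length_fstF_sndF_le (fstF w)
    have a2 := length_fstF_sndF_le (fstF (fstF w))
    have a3 := length_fstF_sndF_le (fstF (fstF (fstF w)))
    simp only [nthF]
    omega
  rw [queryFn, iteFn_of_oneBit (oneBit_ltLenF.comp _)]
  split_ifs
  · rw [iteFn_of_oneBit (oneBit_ltLenF.comp _)]
    split_ifs
    · rw [Function.comp_apply, fanoutFn_apply, blockFn, Function.comp_apply, fanoutFn_apply, takeFn_boolPair]
      refine (List.length_take_le _ _).trans ?_
      simpa using hn
    · rw [Function.comp_apply, fanoutFn_apply, takeFn_boolPair]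
      exact (List.length_take_le _ _).trans hn
  · rw [Function.comp_apply, fanoutFn_apply, takeFn_boolPair]
    exact (List.length_take_le _ _).trans hn

/-- The op of the query search has additive growth. [folklore] -/
theorem length_qOp_le (w : List Bool) : (qOp w).length ≤ (fstF w).length + (sndF w).length + 6 := by
  rw [qOp, iteFn_of_oneBit (oneBit_isNilFn.comp _)]
  split_ifs
  · rw [iteFn_of_oneBit (oneBit_ltLenF.comp _)]
    split_ifs
    · rw [fanoutFn_apply, fanoutFn_apply, length_boolPair, length_boolPair]
      simp only [Function.comp_apply, fanoutFn_apply, List.length_singleton]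
      have h1 := length_queryFn_le (boolPair (sndF w) (fstF (fstF w)))
      rw [fstF_boolPair] at h1
      have h2 := length_fstF_sndF_le (fstF w)
      omega
    · rw [fanoutFn_apply, length_boolPair]
      simp only [Function.comp_apply, fanoutFn_apply, dropFn_boolPair]
      have h2 := length_fstF_sndF_le (fstF w)
      have h3 : (List.drop (nqFn (sndF w)).length (fstF (fstF w))).length ≤ (fstF (fstF w)).length := by
        rw [List.length_drop]; omega
      simp only [length_boolPair, List.length_nil]
      omega
  · omega

end QFn
/-- **The query search**: the final state `⟨rem, ⟨flag, y⟩⟩` after all levels `ℓ' ≤ |r|`, on `x' = ⟨x, 1^{idx}⟩`. [folklore] -/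
noncomputable def qSearchFn : List Bool → List Bool :=
  (sndPow 2 ∘ (foldLoop qOp (clipF 2 qPiece) X ∘ (fanoutFn id (fanoutFn (lenBinF ∘ (appF ∘ (fanoutFn (onesFn ∘ (sndF ∘ fstF)) (fun _ => [true])))) (fanoutFn (fun _ => []) (fanoutFn sndF (fun _ => boolPair [] [])))))))

/-- `qSearchFn ∈ FP`. [folklore] -/
theorem qSearchFn_mem_FP : qSearchFn ∈ FP :=
  (comp_mem_FP (sndPow_mem_FP 2) (comp_mem_FP (foldLoop_clipF_mem_FP (d := 6) 2 qOp_mem_FP length_qOp_le qPiece_mem_FP X) (fanoutFn_mem_FP (PolyTimeComputable.id _) (fanoutFn_mem_FP (comp_mem_FP lenBinF_mem_FP (comp_mem_FP appF_mem_FP (fanoutFn_mem_FP (comp_mem_FP onesFn_mem_FP (comp_mem_FP sndF_mem_FP fstF_mem_FP)) (const_mem_FP _)))) (fanoutFn_mem_FP (const_mem_FP _) (fanoutFn_mem_FP sndF_mem_FP (const_mem_FP _)))))))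

/-- The query bits: the found query, or `0ⁿ` beyond the schedule. [folklore] -/
noncomputable def qBitsFn : List Bool → List Bool :=
  (iteFn (isNilFn ∘ (fstF ∘ (sndF ∘ qSearchFn))) (Kannan.zerosFn ∘ (nthF 0 ∘ (fstF ∘ fstF))) (sndF ∘ (sndF ∘ qSearchFn)))

/-- `qBitsFn ∈ FP`. [folklore] -/
theorem qBitsFn_mem_FP : qBitsFn ∈ FP :=
  (iteFn_mem_FP (comp_mem_FP isNilFn_mem_FP (comp_mem_FP fstF_mem_FP (comp_mem_FP sndF_mem_FP qSearchFn_mem_FP))) (comp_mem_FP Kannan.zerosFn_mem_FP (comp_mem_FP (nthF_mem_FP 0) (comp_mem_FP fstF_mem_FP fstF_mem_FP))) (comp_mem_FP sndF_mem_FP (comp_mem_FP sndF_mem_FP qSearchFn_mem_FP)))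

/-- **The learner's query function `Q`**: on `⟨x, 1^{idx}⟩` the membership query `true :: y_{idx}`.
[cite: CarmosinoImpagliazzoKabanetsKolokolova2016, §5 (complete algorithm)] -/
noncomputable def lrnQFn : List Bool → List Bool := List.cons true ∘ qBitsFn

/-- `lrnQFn ∈ FP`. [folklore] -/
theorem lrnQFn_mem_FP : lrnQFn ∈ FP := comp_mem_FP (cons_mem_FP true) qBitsFn_mem_FP


/-! #### The schedule as a plain function and the value of the query function -/

section Schedule

variable {n a b : ℕ} {r : List Bool}

/-- The state of the query search after the levels `< L`: remaining index and the answer, if found.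
[folklore] -/
noncomputable def qState (n a b : ℕ) (r : List Bool) (idx : ℕ) : ℕ → ℕ × Option (Fin n → Bool)
  | 0 => (idx, none)
  | L + 1 => match qState n a b r idx L with
    | (rem, some y) => (rem, some y)
    | (rem, none) => if rem < lvlNQ n a b r L then (rem, some (lvlQuery n a b r L rem)) else (rem - lvlNQ n a b r L, none)

/-- **The scheduled query of global index `idx`** (`0ⁿ` beyond the schedule). [folklore] -/
noncomputable def schedQuery (n a b : ℕ) (r : List Bool) (idx : ℕ) : Fin n → Bool :=
  ((qState n a b r idx (r.length + 1)).2).getD fun _ => false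

/-- The string encoding of a search state. [folklore] -/
def encodeQState {n : ℕ} : ℕ × Option (Fin n → Bool) → List Bool
  | (rem, none) => boolPair (ones rem) (boolPair [] [])
  | (rem, some y) => boolPair (ones rem) (boolPair [true] (List.ofFn y))

/-- A level with queries is processed. [folklore] -/
theorem processed_of_lt_lvlNQ {rem L : ℕ} (h : rem < lvlNQ n a b r L) :
    LvlProcessed n a b r.length L ∧ rem < prmReps (prmS n a b) L * lvlPerRun n a b L + prmM (prmS n a b) L := by
  rw [lvlNQ] at h
  by_cases hp : LvlProcessed n a b r.length L
  · rw [if_pos hp] at h; exact ⟨hp, h⟩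
  · rw [if_neg hp] at h; exact absurd h (Nat.not_lt_zero _)

/-- **One step of the query search.** [folklore] -/
theorem qOp_apply (hR : 1 ≤ r.length) (st : ℕ × Option (Fin n → Bool)) {L : ℕ} (hL : L ≤ r.length) :
    qOp (boolPair (encodeQState st) (lrnArg n a b r L)) = encodeQState (match st with
      | (rem, some y) => (rem, some y)
      | (rem, none) => if rem < lvlNQ n a b r L then (rem, some (lvlQuery n a b r L rem)) else (rem - lvlNQ n a b r L, none)) := by
  rcases st with ⟨rem, _ | y⟩
  · show _ = encodeQState (if rem < lvlNQ n a b r L then (rem, some (lvlQuery n a b r L rem)) else (rem - lvlNQ n a b r L, none))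
    rw [encodeQState, qOp, iteFn_apply (b := true) (by simp [isNilFn]),
      iteFn_apply (b := decide (rem < lvlNQ n a b r L)) (by
        simp only [Function.comp_apply, fanoutFn_apply, fstF_boolPair, sndF_boolPair, nqFn_apply n a b r hR hL, ltLenF_boolPair,
          length_ones])]
    by_cases h : rem < lvlNQ n a b r L
    · rw [decide_eq_true h, if_pos h]
      simp only [ite_true, fanoutFn_apply, Function.comp_apply, fstF_boolPair, sndF_boolPair, encodeQState]
      obtain ⟨hp, hlt⟩ := processed_of_lt_lvlNQ h
      rw [queryFn_apply hp hlt]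
    · rw [decide_eq_false h, if_neg h]
      simp only [Bool.false_eq_true, ite_false, ite_true, fanoutFn_apply, Function.comp_apply, fstF_boolPair, sndF_boolPair,
        nqFn_apply n a b r hR hL, dropFn_boolPair, length_ones, drop_ones, encodeQState]
  · show _ = encodeQState (rem, some y)
    rw [encodeQState, qOp, iteFn_apply (b := false) (by simp [isNilFn])]
    simp

/-- Value of `qPiece`. [folklore] -/
theorem qPiece_apply (idx j : ℕ) : qPiece (boolPair (boolPair (boolPair (pacParams n a b) r) (ones idx)) (ones j)) = lrnArg n a b r j := by
  simp [qPiece, lrnArg]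

/-- The remaining index never exceeds the original one. [folklore] -/
theorem qState_fst_le (idx : ℕ) : ∀ L, (qState n a b r idx L).1 ≤ idx
  | 0 => le_rfl
  | L + 1 => by
    have ih := qState_fst_le idx L
    rw [qState]
    rcases hq : qState n a b r idx L with ⟨rem, _ | y⟩
    · rw [hq] at ih; dsimp only; split_ifs <;> dsimp only <;> omega
    · rw [hq] at ih; exact ih

/-- **The query-search fold computes `qState`.** [folklore] -/
theorem foldAcc_qOp (hR : 1 ≤ r.length) (idx : ℕ) :
    ∀ L, L ≤ r.length + 1 → foldAcc qOp qPiece (boolPair (boolPair (pacParams n a b) r) (ones idx)) 0 L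
      (encodeQState ((idx, none) : ℕ × Option (Fin n → Bool))) = encodeQState (qState n a b r idx L)
  | 0, _ => rfl
  | L + 1, hL => by
    rw [foldAcc_succ', foldAcc_qOp hR idx L (by omega), zero_add, qPiece_apply, qOp_apply hR _ (by omega), qState]

/-- **Value of `qSearchFn`**: the encoded final search state. [folklore] -/
theorem qSearchFn_apply (hR : 1 ≤ r.length) (idx : ℕ) :
    qSearchFn (boolPair (boolPair (pacParams n a b) r) (ones idx)) = encodeQState (qState n a b r idx (r.length + 1)) := by
  have hrounds : r.length + 1 ≤ X.eval (boolPair (boolPair (pacParams n a b) r) (ones idx)).length := by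
    rw [eval_X, length_boolPair, length_boolPair]; omega
  rw [qSearchFn, Function.comp_apply, Function.comp_apply, fanoutFn_apply, fanoutFn_apply, fanoutFn_apply, fanoutFn_apply, id]
  simp only [Function.comp_apply, fanoutFn_apply, fstF_boolPair, sndF_boolPair, onesFn_eq_ones, appF_boolPair,
    show [true] = ones 1 from rfl, ones_append_ones, lenBinF_apply, length_ones]
  rw [show ([] : List Bool) = ones 0 from rfl,
    show boolPair (ones idx) (boolPair (ones 0) (ones 0)) = encodeQState ((idx, none) : ℕ × Option (Fin n → Bool)) by rfl,
    foldLoop_apply _ _ hrounds, foldAcc_clipF (fun j _ hj => by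
      rw [zero_add] at hj
      rw [qPiece_apply, lrnArg, length_boolPair, length_boolPair, length_boolPair, length_boolPair, length_ones, length_ones]
      omega),
    foldAcc_qOp hR idx _ le_rfl]
  simp only [sndPow, Function.comp_apply, sndF_boolPair]

/-- **Value of the learner's query function**: `lrnQFn ⟨x, 1^{idx}⟩ = true :: y_{idx}` with the
scheduled query `y_{idx} = schedQuery … idx`. [cite: CarmosinoImpagliazzoKabanetsKolokolova2016, §5] -/
theorem lrnQFn_apply (hR : 1 ≤ r.length) (idx : ℕ) :
    lrnQFn (boolPair (boolPair (pacParams n a b) r) (ones idx)) = true :: List.ofFn (schedQuery n a b r idx) := by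
  rw [lrnQFn, Function.comp_apply, qBitsFn, iteFn_of_oneBit (oneBit_isNilFn.comp _), schedQuery]
  simp only [Function.comp_apply, qSearchFn_apply hR idx, fstF_boolPair]
  rcases hq : qState n a b r idx (r.length + 1) with ⟨rem, _ | y⟩
  · simp only [encodeQState, sndF_boolPair, fstF_boolPair, isNilFn, decide_true, ite_true, Option.getD_none]
    have : nthF 0 (pacParams n a b) = ones n := by
      simp [pacParams, nthF, unaryEncodeNat_eq_ones]
    rw [this, Kannan.zerosFn_apply, length_ones]
    simp [List.ofFn_const]
  · simp [encodeQState, isNilFn]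

end Schedule

end Literature.Computability.Learning
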